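import Summits.CriticalPhenomena.SAWScalingLimit.Theorems.SAWDevelopingMapObservableToSLETypeLadderCarvedReductionSqueezeFamily
import HarnessLib

/-!
# The two-piece admissible family WITH ITS DEPTH CLAUSE (piece (T-A fam-e) of stub T-A
# `stub_carvedReduction_squeezeGeometry`)

Crux `SAWDevelopingMap.ObservableToSLE` (stmt-CriticalPhenomena-10472), line `six-class-type-ladder`,
stub T-A `stub_carvedReduction_squeezeGeometry` (the geometry of the moving-carving squeeze).
Landing target:
`Summits/CriticalPhenomena/SAWScalingLimit/Theorems/SAWDevelopingMapObservableToSLETypeLadderCarvedReductionSqueezeFamilyDeep.lean`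
(`--supports stmt-CriticalPhenomena-10472`).  Sequel of `…SqueezeFamily` (p134423).

The two-piece admissible family `twoPiece_exists_innerFamily` (the main component of the DEEP set
of a domain `Ω` with gate boxes) is used TWICE by the squeeze: for the outer Jordan approximant `E`
(outer family `N`) and for the inner hull subdomain `M ⊆ E` (inner family `Λ'`), with the SAME
gates, boxes and thresholds.  The sandwich needs `Λ' δ ⊆ N δ`; this follows from the closure clause
of `N` once every vertex of `Λ' δ` is known to be CLEARLY DEEP (for `M`, hence for `E`).  The landed
statement does not export the depth of the family's vertices, so this file re-proves it with one
more conjunct (`twoPiece_exists_innerFamily_deep`, clause 5): eventually every `v ∈ L δ` has its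
closed `25δ`-disc inside `Ω ∪ X δ` (exempt slabs) and row `≥ m i δ` in the box
`|ΔRe| < ρc + 10δ`, `|ΔIm| < ρc'`.  The passage deep ⇒ clearly deep is
`twoPiece_clearlyDeep_of_deep` (clamp the centre into the gate box; registered as
`stub_carvedReduction_twoPieceClearlyDeep`).
-/

noncomputable section

open scoped Topology
open Filter Set Metric
open Literature.Probability.LatticeModels (HexVertex hexGraph hexCenter Site)
open Literature.Probability.RandomPlanarGeometry
open Literature.Probability.RandomPlanarGeometry.SAW
open Literature.Probability.Percolation (PathIn hexCenter_im hexCenter_re)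

namespace Summit.CriticalPhenomena.SAWScalingLimit.Theorems.ObservableToSLE.TypeLadder

open Summit.CriticalPhenomena.SAWScalingLimit.Theorems.ObservableToSLE.FloorRatio

/-! ### Deep vertices are clearly deep -/

/-- **Deep ⇒ clearly deep (one gate).**  Let the closed box `[Re p ± ρc] × [Im p - ρc', Im p]` miss
`Ω`, let `u'` have its closed `t`-disc in `Ω ∪ X` where `X` has no point `z` with `|Re z - Re p| ≤ ρc`
and `Im p - ρc' ≤ Im z < Im p - g` (`g ≥ 0`), and suppose `|Re u' - Re p| < ρc + 10δ`,
`Im p - ρc' ≤ Im u' < Im p - g`, `10δ ≤ t`.  Contradiction: clamp the abscissa of `u'` into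
`[Re p - ρc, Re p + ρc]` — the clamped point is in the box (not in `Ω`), not in `X`, and within
`10δ ≤ t` of `u'`. -/
theorem twoPiece_clearlyDeep_of_deep {Ω X : Set ℂ} {p u' : ℂ} {ρc ρc' δ g t : ℝ}
    (hB : ∀ z : ℂ, |z.re - p.re| ≤ ρc → p.im - ρc' ≤ z.im → z.im ≤ p.im → z ∉ Ω)
    (hX : ∀ z ∈ X, |z.re - p.re| ≤ ρc → p.im - ρc' ≤ z.im → z.im < p.im - g → False)
    (hball : closedBall u' t ⊆ Ω ∪ X) (hρc : 0 ≤ ρc) (hδ : 0 ≤ δ) (hg : 0 ≤ g)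
    (hre : |u'.re - p.re| < ρc + 10 * δ) (hlo : p.im - ρc' ≤ u'.im) (hhi : u'.im < p.im - g)
    (ht : 10 * δ ≤ t) : False := by
  obtain ⟨hre1, hre2⟩ := abs_lt.1 hre
  -- the clamped abscissa
  set a : ℝ := max (p.re - ρc) (min u'.re (p.re + ρc)) with ha
  have ha1 : p.re - ρc ≤ a := le_max_left _ _
  have ha2 : a ≤ p.re + ρc := max_le (by linarith) (min_le_right _ _)
  have ha3 : |u'.re - a| ≤ 10 * δ := by
    rw [abs_le]
    constructor
    · have : a ≤ max (p.re - ρc) u'.re := max_le_max le_rfl (min_le_left _ _)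
      have h2 : max (p.re - ρc) u'.re ≤ u'.re + 10 * δ := max_le (by linarith) (by linarith)
      linarith
    · rcases le_total u'.re (p.re + ρc) with h1 | h1
      · have : min u'.re (p.re + ρc) = u'.re := min_eq_left h1
        have h2 : u'.re ≤ a := by rw [ha, this]; exact le_max_right _ _
        linarith
      · have : min u'.re (p.re + ρc) = p.re + ρc := min_eq_right h1
        have h2 : p.re + ρc ≤ a := by rw [ha, this]; exact le_max_right _ _
        linarith
  -- the box point
  set x : ℂ := ⟨a, u'.im⟩ with hx
  have hxre : |x.re - p.re| ≤ ρc := by rw [abs_le]; constructor <;> simp [hx] <;> linarith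
  have hxΩ : x ∉ Ω := hB x hxre (by simp [hx]; linarith) (by simp [hx]; linarith)
  have hxX : x ∉ X := fun h => hX x h hxre (by simp [hx]; linarith) (by simp [hx]; linarith)
  have hxball : x ∈ closedBall u' t := by
    rw [mem_closedBall, dist_comm]
    refine (dist_le_abs_re_add_abs_im u' x).trans ?_
    simp only [hx, Complex.sub_re, Complex.sub_im, sub_self, abs_zero, add_zero]
    linarith [ha3]
  rcases hball hxball with h | h
  · exact hxΩ h
  · exact hxX h

/-- **Registered sub-goal `stub_carvedReduction_twoPieceClearlyDeep`** (crux item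
stmt-CriticalPhenomena-10472, stub T-A `stub_carvedReduction_squeezeGeometry`, piece (T-A fam-e)
DEEP VERTICES ARE CLEARLY DEEP): registry form of `twoPiece_clearlyDeep_of_deep`. -/
theorem stub_carvedReduction_twoPieceClearlyDeep :
    ∀ (Ω X : Set ℂ) (p u' : ℂ) (ρc ρc' δ g t : ℝ),
      (∀ z : ℂ, |z.re - p.re| ≤ ρc → p.im - ρc' ≤ z.im → z.im ≤ p.im → z ∉ Ω) →
      (∀ z ∈ X, |z.re - p.re| ≤ ρc → p.im - ρc' ≤ z.im → z.im < p.im - g → False) →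
      closedBall u' t ⊆ Ω ∪ X → 0 ≤ ρc → 0 ≤ δ → 0 ≤ g → |u'.re - p.re| < ρc + 10 * δ →
      p.im - ρc' ≤ u'.im → u'.im < p.im - g → 10 * δ ≤ t → False :=
  fun _ _ _ _ _ _ _ _ _ hB hX hball hρc hδ hg hre hlo hhi ht =>
    twoPiece_clearlyDeep_of_deep hB hX hball hρc hδ hg hre hlo hhi ht

/-! ### The family with its depth clause -/

/-- **THE TWO-PIECE ADMISSIBLE FAMILY, with the depth of its vertices exported** (clause 5):
verbatim `twoPiece_exists_innerFamily` (clauses 1–4) and, eventually, every `v ∈ L δ` has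
`closedBall (δ c_v) (25δ) ⊆ Ω ∪ X δ` and row `≥ m i δ` whenever `|Re(δ c_v) - Re(p i)| < ρc + 10δ`
and `|Im(δ c_v) - Im(p i)| < ρc'`. -/
theorem twoPiece_exists_innerFamily_deep {Ω : Set ℂ} {p : Fin 2 → ℂ} {ρc ρc' ρF : ℝ}
    (hΩo : IsOpen Ω) (hΩc : IsConnected Ω) (hΩb : Bornology.IsBounded Ω)
    (hE : IsConnected (closure Ω)ᶜ) (hEfr : frontier (closure Ω)ᶜ = frontier Ω)
    (hρc : 0 < ρc) (hρc' : 0 < ρc') (hρF : 0 < ρF) (hFc : ρF ≤ ρc) (hFc' : ρF ≤ ρc')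
    (hsep : ∀ i j, i ≠ j → 2 * (ρc + ρc') + ρF ≤ dist (p i) (p j))
    (hB : ∀ i (z : ℂ), |z.re - (p i).re| ≤ ρc → (p i).im - ρc' ≤ z.im → z.im ≤ (p i).im → z ∉ Ω)
    (hfl : ∀ i, {z : ℂ | (p i).im < z.im} ∩ ball (p i) ρF ⊆ Ω)
    {m : Fin 2 → ℝ → ℤ}
    (hm_lo : ∀ i (δ : ℝ) (u : HexVertex), 0 < δ → ((δ : ℂ) * hexCenter u).im ≤ (p i).im → u.1 1 < m i δ)
    (hm_hi : ∀ i, ∀ ε > (0 : ℝ), ∀ᶠ δ : ℝ in 𝓝[>] 0, ∀ u : HexVertex, u.1 1 < m i δ →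
      ((δ : ℂ) * hexCenter u).im < (p i).im + ε) :
    ∃ L : ℝ → Finset HexVertex,
      (∀ᶠ δ : ℝ in 𝓝[>] 0, hexDomainSimplyConnected (L δ) ∧
        (hexGraph.induce (↑(L δ) : Set HexVertex)).Preconnected ∧
        ∀ v ∈ L δ, (δ : ℂ) * hexCenter v ∈ Ω) ∧
      (∀ K : Set ℂ, IsCompact K → K ⊆ Ω →
        ∀ᶠ δ : ℝ in 𝓝[>] 0, ∀ v : HexVertex, (δ : ℂ) * hexCenter v ∈ K → v ∈ L δ) ∧
      (∀ᶠ δ : ℝ in 𝓝[>] 0, ∀ (i : Fin 2) (v : HexVertex), dist ((δ : ℂ) * hexCenter v) (p i) < ρF / 32 →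
        (v ∈ L δ ↔ m i δ ≤ v.1 1)) ∧
      (∀ᶠ δ : ℝ in 𝓝[>] 0, ∀ z w : HexVertex, z ∈ L δ →
        PathIn hexGraph {u : HexVertex | (δ : ℂ) * hexCenter u ∈ Ω ∧
          closedBall ((δ : ℂ) * hexCenter u) (25 * δ) ⊆ Ω ∪
            ⋃ i, {x : ℂ | |x.re - (p i).re| ≤ ρc ∧ (p i).im - 30 * δ ≤ x.im ∧ x.im ≤ (p i).im} ∧
          ∀ i, |((δ : ℂ) * hexCenter u).re - (p i).re| < ρc + 10 * δ →
            |((δ : ℂ) * hexCenter u).im - (p i).im| < ρc' → m i δ ≤ u.1 1} z w → w ∈ L δ) ∧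
      (∀ᶠ δ : ℝ in 𝓝[>] 0, ∀ v ∈ L δ,
        closedBall ((δ : ℂ) * hexCenter v) (25 * δ) ⊆ Ω ∪
            ⋃ i, {x : ℂ | |x.re - (p i).re| ≤ ρc ∧ (p i).im - 30 * δ ≤ x.im ∧ x.im ≤ (p i).im} ∧
          ∀ i, |((δ : ℂ) * hexCenter v).re - (p i).re| < ρc + 10 * δ →
            |((δ : ℂ) * hexCenter v).im - (p i).im| < ρc' → m i δ ≤ v.1 1) := by
  classical
  -- a bound for `Ω`
  obtain ⟨R, hR0, hΩR⟩ := hΩb.subset_ball_lt 0 0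
  have hR : ∀ z ∈ Ω, ‖z‖ < R := fun z hz => mem_ball_zero_iff.1 (hΩR hz)
  -- the internal data at mesh `δ`
  set mlo : Fin 2 → ℝ → ℤ := fun i δ =>
    ⌈((p i).im - ρc' + 8 * δ) / (δ * (Real.sqrt 3 / 2)) - 1 / 3⌉ with hmlo
  set X : ℝ → Set ℂ := fun δ =>
    ⋃ i, {x : ℂ | |x.re - (p i).re| ≤ ρc ∧ (p i).im - 30 * δ ≤ x.im ∧ x.im ≤ (p i).im} with hX
  set S : ℝ → Set HexVertex := fun δ => {u : HexVertex | (δ : ℂ) * hexCenter u ∈ Ω ∧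
    (∀ i, ¬ (|((δ : ℂ) * hexCenter u).re - (p i).re| < ρc + 10 * δ ∧ mlo i δ ≤ u.1 1 ∧ u.1 1 < m i δ)) ∧
    closedBall ((δ : ℂ) * hexCenter u) (25 * δ) ⊆ Ω ∪ X δ} with hS
  -- the base point and base vertex
  set x₀ : ℂ := p 0 + ((ρF / 4 : ℝ) : ℂ) * Complex.I with hx₀
  have hball : ∀ i, closedBall (p i + ((ρF / 4 : ℝ) : ℂ) * Complex.I) (ρF / 16) ⊆ Ω := by
    intro i z hz
    rw [mem_closedBall, dist_eq_norm] at hz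
    refine hfl i ⟨?_, ?_⟩
    · show (p i).im < z.im
      have h1 : (p i + ((ρF / 4 : ℝ) : ℂ) * Complex.I).im - z.im ≤ ‖z - (p i + ((ρF / 4 : ℝ) : ℂ) * Complex.I)‖ := by
        rw [← norm_neg, neg_sub, ← Complex.sub_im]; exact Complex.im_le_norm _
      have h2 : (p i + ((ρF / 4 : ℝ) : ℂ) * Complex.I).im = (p i).im + ρF / 4 := by simp
      linarith
    · rw [mem_ball, dist_eq_norm]
      calc ‖z - p i‖ = ‖(z - (p i + ((ρF / 4 : ℝ) : ℂ) * Complex.I)) + ((ρF / 4 : ℝ) : ℂ) * Complex.I‖ := by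
            congr 1; ring
        _ ≤ ‖z - (p i + ((ρF / 4 : ℝ) : ℂ) * Complex.I)‖ + ‖((ρF / 4 : ℝ) : ℂ) * Complex.I‖ := norm_add_le _ _
        _ ≤ ρF / 16 + ρF / 4 := by
            refine add_le_add hz ?_
            rw [norm_mul, Complex.norm_real, Complex.norm_I, mul_one, Real.norm_of_nonneg (by positivity)]
        _ < ρF := by linarith
  have hx₀Ω : x₀ ∈ Ω := hball 0 (mem_closedBall_self (by positivity))
  have hv₀ex : ∀ δ : ℝ, 0 < δ → ∃ v : HexVertex, dist ((δ : ℂ) * hexCenter v) x₀ ≤ δ :=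
    fun δ hδ => exists_vertex_dist_le hδ x₀
  set v₀ : ℝ → HexVertex := fun δ => if hδ : 0 < δ then (hv₀ex δ hδ).choose else ((0 : Site 2), 0)
    with hv₀
  have hv₀d : ∀ δ : ℝ, 0 < δ → dist ((δ : ℂ) * hexCenter (v₀ δ)) x₀ ≤ δ := by
    intro δ hδ
    have e : v₀ δ = (hv₀ex δ hδ).choose := by simp only [hv₀, dif_pos hδ]
    rw [e]; exact (hv₀ex δ hδ).choose_spec
  -- the hypotheses of the inner-domain lemma at a good mesh
  set δ₁ : ℝ := min (ρc / 40) (ρc' / 80) with hδ₁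
  have hδ₁0 : 0 < δ₁ := lt_min (by positivity) (by positivity)
  have hgood : ∀ δ : ℝ, 0 < δ → δ ≤ δ₁ →
      (∀ u, u ∈ S δ ↔ ((δ : ℂ) * hexCenter u ∈ Ω ∧
        (∀ i, ¬ (|((δ : ℂ) * hexCenter u).re - (p i).re| < ρc + 10 * δ ∧ mlo i δ ≤ u.1 1 ∧ u.1 1 < m i δ)) ∧
        closedBall ((δ : ℂ) * hexCenter u) (25 * δ) ⊆ Ω ∪ X δ)) ∧
      (∀ z ∈ X δ, ∃ i, |z.re - (p i).re| ≤ (ρc + 10 * δ) - 10 * δ ∧ (p i).im - 30 * δ ≤ z.im ∧ z.im ≤ (p i).im) ∧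
      (∀ i (u : HexVertex), ((δ : ℂ) * hexCenter u).im ≤ (p i).im → u.1 1 < m i δ) ∧
      (∀ i (u : HexVertex), (p i).im - ρc' / 2 ≤ ((δ : ℂ) * hexCenter u).im → mlo i δ ≤ u.1 1) ∧
      (∀ i (u : HexVertex), mlo i δ ≤ u.1 1 → (p i).im - ρc' + 8 * δ ≤ ((δ : ℂ) * hexCenter u).im) := by
    intro δ hδ hδle
    have hδc' : δ ≤ ρc' / 80 := hδle.trans (min_le_right _ _)
    refine ⟨fun u => Iff.rfl, fun z hz => ?_, fun i u hu => hm_lo i δ u hδ hu, fun i u hu => ?_, fun i u hu => ?_⟩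
    · obtain ⟨i, hi⟩ := mem_iUnion.1 hz
      exact ⟨i, by linarith [hi.1], hi.2.1, hi.2.2⟩
    · exact (twoPiece_mlo_spec hδ (by linarith) (p i).im).2 u hu
    · exact (twoPiece_mlo_spec hδ (by linarith) (p i).im).1 u hu
  -- deep vertices are clearly deep
  have hclear : ∀ δ : ℝ, 0 < δ → δ ≤ δ₁ → ∀ u ∈ S δ,
      closedBall ((δ : ℂ) * hexCenter u) (25 * δ) ⊆ Ω ∪ X δ ∧
        ∀ i, |((δ : ℂ) * hexCenter u).re - (p i).re| < ρc + 10 * δ →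
          |((δ : ℂ) * hexCenter u).im - (p i).im| < ρc' → m i δ ≤ u.1 1 := by
    intro δ hδ hδle u hu
    have hδc' : δ ≤ ρc' / 80 := hδle.trans (min_le_right _ _)
    obtain ⟨-, -, -, hmlo', -⟩ := hgood δ hδ hδle
    refine ⟨hu.2.2, fun i hre him => ?_⟩
    by_contra hlt
    push Not at hlt
    have hrow : u.1 1 < mlo i δ := by
      by_contra hge
      push Not at hge
      exact hu.2.1 i ⟨hre, hge, hlt⟩
    have hhi : ((δ : ℂ) * hexCenter u).im < (p i).im - ρc' / 2 := by
      by_contra hge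
      push Not at hge
      exact (hmlo' i u hge).not_gt hrow
    have hlo : (p i).im - ρc' ≤ ((δ : ℂ) * hexCenter u).im := by linarith [(abs_lt.1 him).1]
    refine twoPiece_clearlyDeep_of_deep (X := X δ) (g := ρc' / 2) (hB i) ?_ hu.2.2 hρc.le hδ.le
      (by positivity) hre hlo hhi (by linarith)
    intro z hz hzre hzlo hzhi
    obtain ⟨i', hi'⟩ := mem_iUnion.1 hz
    by_cases hii : i' = i
    · subst hii
      linarith [hi'.2.1]
    · -- the other slab is far away
      have hfar := hsep i i' (Ne.symm hii)
      have h1 : dist (p i) (p i') ≤ |(p i - p i').re| + |(p i - p i').im| := dist_le_abs_re_add_abs_im _ _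
      have h2 : |(p i - p i').re| ≤ 2 * ρc := by
        rw [Complex.sub_re, abs_le]
        obtain ⟨a1, a2⟩ := abs_le.1 hzre
        obtain ⟨b1, b2⟩ := abs_le.1 hi'.1
        constructor <;> linarith
      have h3 : |(p i - p i').im| ≤ ρc' + 30 * δ := by
        rw [Complex.sub_im, abs_le]
        constructor <;> linarith [hi'.2.1, hi'.2.2]
      linarith
  have hinner : ∀ δ : ℝ, 0 < δ ∧ δ ≤ δ₁ → ∃ Λ : Finset HexVertex, hexDomainSimplyConnected Λ ∧
      (hexGraph.induce (↑Λ : Set HexVertex)).Preconnected ∧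
      ∀ z : HexVertex, z ∈ Λ ↔ PathIn hexGraph (S δ) (v₀ δ) z := by
    rintro δ ⟨hδ, hδle⟩
    have hδc : δ ≤ ρc / 40 := hδle.trans (min_le_left _ _)
    have hδc' : δ ≤ ρc' / 80 := hδle.trans (min_le_right _ _)
    obtain ⟨hS', hX', hμ, hmlo', hzone⟩ := hgood δ hδ hδle
    exact twoPiece_exists_inner_finset (ρₓ := ρc + 10 * δ) (σ := 30 * δ) (D := ρc' / 2) hδ (by linarith)
      hR0.le hR hE hEfr (by linarith) (by linarith) (by linarith) (by linarith) (by positivity)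
      hS' hX' hB hμ hmlo' hzone (v₀ δ)
  -- deep reachability of compacts, in the form used twice below
  have hreachK : ∀ K : Set ℂ, IsCompact K → K ⊆ Ω → ∀ᶠ δ : ℝ in 𝓝[>] 0, 0 < δ ∧ δ ≤ δ₁ ∧
      ∀ v : HexVertex, (δ : ℂ) * hexCenter v ∈ K → PathIn hexGraph (S δ) (v₀ δ) v := by
    intro K hK hKΩ
    obtain ⟨ε, hε, hreach⟩ := twoPiece_pathIn_of_isCompact hΩo hΩc hρc.le hρc'.le hB hK hKΩ hx₀Ω
    have hev : ∀ᶠ δ : ℝ in 𝓝[>] 0, δ ∈ Ioc 0 (min δ₁ (ε / 50)) :=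
      Ioc_mem_nhdsGT (lt_min hδ₁0 (by positivity))
    filter_upwards [hev, hm_hi 0 (ε / 8) (by positivity), hm_hi 1 (ε / 8) (by positivity)] with δ hδ h0 h1
    have hδle : δ ≤ δ₁ := hδ.2.trans (min_le_left _ _)
    refine ⟨hδ.1, hδle, fun v hv => ?_⟩
    have hthr : ∀ i (u : HexVertex), u.1 1 < m i δ → ((δ : ℂ) * hexCenter u).im < (p i).im + ε / 8 := by
      intro i u hu; fin_cases i
      · exact h0 u hu
      · exact h1 u hu
    obtain ⟨-, -, -, -, hzone⟩ := hgood δ hδ.1 hδle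
    exact hreach δ (fun i => m i δ) (fun i => mlo i δ) (X δ) hδ.1 (hδ.2.trans (min_le_right _ _)) hthr
      (fun i u hu => by linarith [hzone i u hu, hδ.1]) (v₀ δ) v (hv₀d δ hδ.1) hv
  refine ⟨fun δ => if hδ : 0 < δ ∧ δ ≤ δ₁ then (hinner δ hδ).choose else ∅, ?_, ?_, ?_, ?_, ?_⟩
  · -- simply connected, connected, inside `Ω`
    filter_upwards [Ioc_mem_nhdsGT hδ₁0] with δ hδ
    rw [dif_pos (show 0 < δ ∧ δ ≤ δ₁ from hδ)]
    obtain ⟨h1, h2, h3⟩ := (hinner δ hδ).choose_spec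
    exact ⟨h1, h2, fun v hv => ((h3 v).1 hv).right_mem.1⟩
  · -- exhaustion of compacts
    intro K hK hKΩ
    filter_upwards [hreachK K hK hKΩ] with δ ⟨hδ, hδle, hK'⟩ v hv
    rw [dif_pos (show 0 < δ ∧ δ ≤ δ₁ from ⟨hδ, hδle⟩), ((hinner δ ⟨hδ, hδle⟩).choose_spec).2.2]
    exact hK' v hv
  · -- exact rows near the gates
    set K₀ : Set ℂ := ⋃ i, closedBall (p i + ((ρF / 4 : ℝ) : ℂ) * Complex.I) (ρF / 16) with hK₀
    have hK₀c : IsCompact K₀ := isCompact_iUnion fun i => isCompact_closedBall _ _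
    have hK₀Ω : K₀ ⊆ Ω := iUnion_subset hball
    have hev : ∀ᶠ δ : ℝ in 𝓝[>] 0, δ ∈ Ioc 0 (ρF / 64) := Ioc_mem_nhdsGT (by positivity)
    filter_upwards [hreachK K₀ hK₀c hK₀Ω, hev, hm_hi 0 ρc' hρc', hm_hi 1 ρc' hρc']
      with δ ⟨hδ, hδle, hreach⟩ hδF h0 h1 i v hvp
    have hδc : δ ≤ ρc / 40 := hδle.trans (min_le_left _ _)
    obtain ⟨-, -, hμ, hmlo', hzone⟩ := hgood δ hδ hδle
    rw [dif_pos (show 0 < δ ∧ δ ≤ δ₁ from ⟨hδ, hδle⟩), ((hinner δ ⟨hδ, hδle⟩).choose_spec).2.2]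
    constructor
    · -- members have row `≥ m`
      intro hv
      have hvS : v ∈ S δ := hv.right_mem
      by_contra hlt
      push Not at hlt
      refine hvS.2.1 i ⟨?_, hmlo' i v ?_, hlt⟩
      · have := (Complex.abs_re_le_norm _).trans_eq' (by rw [Complex.sub_re]) |>.trans_lt
          (by rw [← dist_eq_norm]; exact hvp : ‖(δ : ℂ) * hexCenter v - p i‖ < ρF / 32)
        linarith
      · have := im_sub_im_le_dist (p i) ((δ : ℂ) * hexCenter v)
        rw [dist_comm] at this
        linarith
    · -- rows `≥ m` ascend to the target disc through deep vertices
      intro hvm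
      have hvim : (p i).im < ((δ : ℂ) * hexCenter v).im := by
        by_contra hle; push Not at hle
        exact (hμ i v hle).not_ge hvm
      have hthr : ∀ j (u : HexVertex), u.1 1 < m j δ → ((δ : ℂ) * hexCenter u).im < (p j).im + ρc' := by
        intro j u hu; fin_cases j
        · exact h0 u hu
        · exact h1 u hu
      set y : ℂ := (δ : ℂ) * hexCenter v + ((ρF / 4 : ℝ) : ℂ) * Complex.I with hy
      have hyv : dist ((δ : ℂ) * hexCenter v) y = ρF / 4 := by
        rw [dist_comm, hy, dist_eq_norm, add_sub_cancel_left, norm_mul, Complex.norm_real, Complex.norm_I,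
          mul_one, Real.norm_of_nonneg (by positivity)]
      obtain ⟨z, q, hz, hq⟩ := exists_walk_dist_smul_le hδ v y
      have hvz : PathIn hexGraph (S δ) v z := by
        refine pathIn_of_walk q fun u hu => ?_
        exact twoPiece_ascent_deep hδ hFc (by linarith [hδF.2]) hsep hfl hthr
          (fun j u hu => by linarith [hzone j u hu]) i hvp hvim hvm ((hq u hu).trans_eq hyv)
      have h3 : δ / Real.sqrt 3 ≤ δ := by
        refine div_le_self hδ.le ?_
        rw [show (1 : ℝ) = Real.sqrt 1 by simp]
        exact Real.sqrt_le_sqrt (by norm_num)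
      have hzK : (δ : ℂ) * hexCenter z ∈ K₀ := by
        refine mem_iUnion.2 ⟨i, mem_closedBall.2 ?_⟩
        calc dist ((δ : ℂ) * hexCenter z) (p i + ((ρF / 4 : ℝ) : ℂ) * Complex.I)
            ≤ dist ((δ : ℂ) * hexCenter z) y + dist y (p i + ((ρF / 4 : ℝ) : ℂ) * Complex.I) :=
              dist_triangle _ _ _
          _ ≤ δ + ρF / 32 := by
              refine add_le_add (hz.trans h3) ?_
              rw [hy, dist_add_right]; exact hvp.le
          _ ≤ ρF / 16 := by linarith [hδF.2]
      exact (hreach z hzK).trans hvz.symm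
  · -- closure under clearly-deep paths
    filter_upwards [Ioc_mem_nhdsGT hδ₁0, hm_hi 0 ρc' hρc', hm_hi 1 ρc' hρc'] with δ hδ h0 h1 z w hz hzw
    obtain ⟨-, -, -, -, hzone⟩ := hgood δ hδ.1 hδ.2
    have hthr : ∀ j (u : HexVertex), u.1 1 < m j δ → ((δ : ℂ) * hexCenter u).im < (p j).im + ρc' := by
      intro j u hu; fin_cases j
      · exact h0 u hu
      · exact h1 u hu
    rw [dif_pos (show 0 < δ ∧ δ ≤ δ₁ from hδ), ((hinner δ hδ).choose_spec).2.2] at hz ⊢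
    refine hz.trans (hzw.mono fun u hu => ?_)
    exact twoPiece_deep_of_clearlyDeep hthr (fun j u hu' => by linarith [hzone j u hu', hδ.1]) hu.1 hu.2.1
      hu.2.2
  · -- depth of the members (NEW clause)
    filter_upwards [Ioc_mem_nhdsGT hδ₁0] with δ hδ v hv
    rw [dif_pos (show 0 < δ ∧ δ ≤ δ₁ from hδ), ((hinner δ hδ).choose_spec).2.2] at hv
    exact hclear δ hδ.1 hδ.2 v hv.right_mem

end Summit.CriticalPhenomena.SAWScalingLimit.Theorems.ObservableToSLE.TypeLadder

end
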